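import Literature.NumberTheory.ModularForms.SiegelUnitsProduct
import Literature.NumberTheory.ModularForms.LogLambda
import Literature.NumberTheory.EllipticCurves.EisensteinSeriesWeightTwoCharacter
import Literature.NumberTheory.ModularForms.EisensteinLatticeCosetQExpansion
import Mathlib.Analysis.SumOverResidueClass
import HarnessLib

/-!
# `∑_b ψ(b) G_b = −2 E₂^{𝟙,ψ}`: the weight-two Eisenstein series of a primitive even character as a
# character sum of logarithmic derivatives of Siegel units; holomorphic logarithms of the units

Topic `Literature/NumberTheory/ModularForms`; namespace `Literature.NumberTheory.ModularForms`.
Sequel of `SiegelUnitsProduct` ((log 𝒱_b)′ = 2πi·12·G_b). For a Dirichlet character `ψ` modulo `N`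
which is PRIMITIVE, EVEN and `≠ 1`, the series `G_b` (`siegelG N b`) satisfy

  `∑_{j mod N} ψ(j) G_j(τ) = −2 · E₂^{𝟙,ψ}(τ)`   (`sum_character_mul_siegelG`)

on `ℍ`, where `E₂^{𝟙,ψ} = eisensteinE2Char ψ` is the tree's weight-`2` Eisenstein series
(`EisensteinSeriesWeightTwoCharacter`: `a₀ = −B_{2,ψ}/4`, `aₙ = σ₁^ψ(n) = ∑_{d∣n} ψ(d)d`). Proof:
the constant terms give `∑_j ψ(j)(N/2)B₂(j/N) = B_{2,ψ}/2` (`sum_character_mul_siegelR`); both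
progressions `m ≡ ±j` contribute the Lambert series `T = ∑_{m≥1} ψ(m) m q^m/(1−q^m)`
(`Nat.sumByResidueClasses`, `j ↦ −j` and `ψ(−1) = 1`), and `T = ∑_{n≥1} σ₁^ψ(n) qⁿ` (resummation
`tsum_prod_weight_mul_pow_eq` of `EisensteinLatticeCosetQExpansion`); `eisensteinE2Char_apply` and
`eisensteinE2CharConst_mul_LFunction_two` identify the right-hand side. This is the classical fact
that `E₂^{𝟙,ψ}(z)dz` is, up to `2πi·(−24)`, the logarithmic differential of the modular unit
`∏_b 𝒱_b^{ψ(b)}` (Kubert–Lang, *Modular Units*, Ch. 4; Diamond–Shurman §4.8).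

Second part: **holomorphic logarithms of the units** (`exists_mdifferentiable_log_siegelLevel`, from
the tree's `exists_continuous_cexp_eq` / `mdifferentiable_of_cexp_eq` on the simply connected `ℍ`)
and their derivative `(L_b ∘ ofComplex)′ = 2πi · 12 · G_{b mod N}` (`deriv_log_siegelLevel`).

Everything is proved; no named facts.

## References

* [KubertLang1981] D. S. Kubert, S. Lang, *Modular Units*, Grundlehren 244 (1981), Ch. 4 §1.
* [DiamondShurman2005] F. Diamond, J. Shurman, *A First Course in Modular Forms*, GTM 228 (2005),
  §4.6 (Thm. 4.6.2), §4.8.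
* [BillereyMenares2018] N. Billerey, R. Menares, Trans. AMS 370 (2018), §1.3 (7.1.3).
-/

noncomputable section

open Complex Set Function Filter
open UpperHalfPlane hiding I
open scoped Real Topology MatrixGroups Manifold

namespace Literature.NumberTheory.ModularForms

open Literature.NumberTheory.EllipticCurves.ModularForms Literature.NumberTheory.LFunctions

local notation "𝕢" => Periodic.qParam
local notation "ℍₒ" => upperHalfPlaneSet

section Star

variable {N : ℕ} [NeZero N] (ψ : DirichletCharacter ℂ N)

/-! ### The constant terms: `∑_j ψ(j) r_j/12 = B_{2,ψ}/2` -/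

/-- `B₂(x) = x² − x + 1/6`. [folklore] -/
theorem bernoulli_two_eval (x : ℚ) : (Polynomial.bernoulli 2).eval x = x ^ 2 - x + 1 / 6 := by
  rw [Polynomial.bernoulli, Finset.sum_range_succ, Finset.sum_range_succ, Finset.sum_range_one]
  simp only [Polynomial.eval_add, Polynomial.eval_monomial, bernoulli_zero, bernoulli_one,
    bernoulli_eq_bernoulli'_of_ne_one (show (2 : ℕ) ≠ 1 by norm_num), bernoulli'_two]
  norm_num
  ring

omit [NeZero N] in
/-- `N·B₂(c/N) = c²/N − c + N/6` for `N ≠ 0`. [folklore] -/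
theorem genBernoulliCoeff_two (hN : N ≠ 0) (c : ℕ) :
    genBernoulliCoeff 2 N c = (c : ℚ) ^ 2 / N - c + N / 6 := by
  rw [genBernoulliCoeff_of_one_le (by norm_num : 1 ≤ 2), bernoulli_two_eval]
  have hN' : (N : ℚ) ≠ 0 := Nat.cast_ne_zero.mpr hN
  field_simp
  ring

/-- `r_c/12 = (1/2)·(c²/N − c + N/6) = genBernoulliCoeff 2 N c / 2` in `ℂ`. [folklore] -/
theorem siegelR_div_twelve (c : ℕ) :
    siegelR N c / 12 = algebraMap ℚ ℂ (genBernoulliCoeff 2 N c) / 2 := by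
  rw [genBernoulliCoeff_two (NeZero.ne N), siegelR_def]
  have hN : (N : ℂ) ≠ 0 := Nat.cast_ne_zero.mpr (NeZero.ne N)
  rw [eq_ratCast]
  push_cast
  field_simp
  ring

/-- **The constant terms**: `∑_{j mod N} ψ(j) · r_j/12 = B_{2,ψ}/2`. [cite: DiamondShurman2005, §4.7 (4.30)] -/
theorem sum_character_mul_siegelR :
    ∑ j : ZMod N, ψ j * (siegelR N j.val / 12) = generalizedBernoulli 2 ψ / 2 := by
  rw [generalizedBernoulli_eq_sum, Finset.sum_div]
  refine Finset.sum_congr rfl fun j _ ↦ ?_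
  rw [siegelR_div_twelve]
  ring

/-! ### The Lambert series `T = ∑ ψ(m) m q^m/(1 − q^m)` and the two progressions -/

variable {ψ}

omit [NeZero N] in
/-- The twisted Lambert term `ψ(m) m q^m/(1 − q^m)`. [folklore] -/
def lambertTerm (ψ : DirichletCharacter ℂ N) (q : ℂ) (m : ℕ) : ℂ :=
  ψ m * ((m : ℂ) * q ^ m / (1 - q ^ m))

omit [NeZero N] in
/-- Unfolding lemma. [folklore] -/
theorem lambertTerm_def (q : ℂ) (m : ℕ) :
    lambertTerm ψ q m = ψ m * ((m : ℂ) * q ^ m / (1 - q ^ m)) := rfl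

omit [NeZero N] in
/-- `|ψ(m)| ≤ 1`. [folklore] -/
theorem norm_dirichletCharacter_le_one (m : ℕ) : ‖ψ m‖ ≤ 1 :=
  DirichletCharacter.norm_le_one ψ _

omit [NeZero N] in
/-- Summability of the twisted Lambert series for `‖q‖ < 1`. [folklore] -/
theorem summable_lambertTerm {q : ℂ} (hq : ‖q‖ < 1) : Summable (lambertTerm ψ q) := by
  have hS : Summable fun m : ℕ ↦ (m : ℂ) ^ 1 * q ^ m / (1 - q ^ m) :=
    summable_norm_pow_mul_geometric_div_one_sub 1 hq
  refine Summable.of_norm_bounded hS.norm fun m ↦ ?_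
  rw [lambertTerm_def, norm_mul, pow_one]
  exact mul_le_of_le_one_left (norm_nonneg _) (norm_dirichletCharacter_le_one m)

/-- `ψ(j.val + Nm) = ψ(j)`. [folklore] -/
theorem dirichletCharacter_val_add_mul (j : ZMod N) (m : ℕ) : ψ ((j.val + N * m : ℕ) : ZMod N) = ψ j := by
  congr 1
  push_cast
  rw [ZMod.natCast_zmod_val, ZMod.natCast_self, zero_mul, add_zero]

/-- **The first progressions**: `∑_j ψ(j) ∑_{n≥0} (Nn+j)Q^{Nn+j}/(1−Q^{Nn+j}) = T`
(summing over residue classes, `Nat.sumByResidueClasses`). [folklore] -/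
theorem sum_character_mul_tsum_prog {q : ℂ} (hq : ‖q‖ < 1) :
    ∑ j : ZMod N, ψ j * ∑' n : ℕ, ((N * n + j.val : ℕ) : ℂ) * q ^ (N * n + j.val) /
        (1 - q ^ (N * n + j.val)) = ∑' m : ℕ, lambertTerm ψ q m := by
  rw [Nat.sumByResidueClasses (summable_lambertTerm hq) N]
  refine Finset.sum_congr rfl fun j _ ↦ ?_
  rw [← tsum_mul_left]
  refine tsum_congr fun n ↦ ?_
  rw [lambertTerm_def, dirichletCharacter_val_add_mul, Nat.add_comm j.val (N * n)]

/-- The second family of exponents: `N n + (N − j.val) = N n + (−j).val` for `j ≠ 0`. [folklore] -/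
theorem sub_val_eq_neg_val {j : ZMod N} (hj : j ≠ 0) : N - j.val = (-j).val := by
  rw [ZMod.neg_val, if_neg hj]

/-- `ψ(0) = 0` for `ψ ≠ 1` (then `N ≠ 1`). [folklore] -/
theorem dirichletCharacter_map_zero (hψ1 : ψ ≠ 1) : ψ (0 : ZMod N) = 0 := by
  have hN1 : N ≠ 1 := by
    rintro rfl
    exact hψ1 (Subsingleton.elim _ _ : ψ = 1) |>.elim
  haveI : Nontrivial (ZMod N) := ZMod.nontrivial_iff.mpr hN1
  exact ψ.map_nonunit not_isUnit_zero

/-- **The second progressions**: `∑_j ψ(j) ∑_{n≥0} (Nn+N−j)Q^{Nn+N−j}/(1−Q^{Nn+N−j}) = T` as well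
(`j ↦ −j`, `ψ` even, `ψ(0) = 0`). [folklore] -/
theorem sum_character_mul_tsum_prog' (hψ1 : ψ ≠ 1) (heven : ψ (-1) = 1) {q : ℂ} (hq : ‖q‖ < 1) :
    ∑ j : ZMod N, ψ j * ∑' n : ℕ, ((N * n + (N - j.val) : ℕ) : ℂ) * q ^ (N * n + (N - j.val)) /
        (1 - q ^ (N * n + (N - j.val))) = ∑' m : ℕ, lambertTerm ψ q m := by
  have h0 := dirichletCharacter_map_zero hψ1
  -- replace `N − j.val` by `(−j).val` (the `j = 0` term vanishes)
  have hterm : ∀ j : ZMod N, ψ j * ∑' n : ℕ, ((N * n + (N - j.val) : ℕ) : ℂ) * q ^ (N * n + (N - j.val)) /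
      (1 - q ^ (N * n + (N - j.val))) =
      ψ j * ∑' n : ℕ, ((N * n + (-j).val : ℕ) : ℂ) * q ^ (N * n + (-j).val) /
        (1 - q ^ (N * n + (-j).val)) := by
    intro j
    by_cases hj : j = 0
    · rw [hj, h0, zero_mul, zero_mul]
    · rw [sub_val_eq_neg_val hj]
  rw [Finset.sum_congr rfl fun j _ ↦ hterm j]
  -- reindex `j ↦ −j` and use evenness
  rw [← Equiv.sum_comp (Equiv.neg (ZMod N)) _]
  simp only [Equiv.neg_apply, neg_neg]
  have hev : ∀ j : ZMod N, ψ (-j) = ψ j := fun j ↦ by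
    rw [← neg_one_mul, map_mul, heven, one_mul]
  simp_rw [hev]
  exact sum_character_mul_tsum_prog hq

/-! ### `T = ∑_{n ≥ 1} σ₁^ψ(n) qⁿ` -/

/-- `q^m/(1 − q^m) = ∑_{c ≥ 1} q^{mc}` for `m ≥ 1`, `‖q‖ < 1`. [folklore] -/
theorem pow_div_one_sub_eq_tsum {q : ℂ} (hq : ‖q‖ < 1) (m : ℕ+) :
    q ^ (m : ℕ) / (1 - q ^ (m : ℕ)) = ∑' c : ℕ+, q ^ ((m : ℕ) * (c : ℕ)) := by
  have hqm : ‖q ^ (m : ℕ)‖ < 1 := by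
    rw [norm_pow]; exact pow_lt_one₀ (norm_nonneg _) hq m.ne_zero
  rw [tsum_pnat_eq_tsum_succ (f := fun c : ℕ ↦ q ^ ((m : ℕ) * c)),
    show (fun c : ℕ ↦ q ^ ((m : ℕ) * (c + 1))) = fun c : ℕ ↦ q ^ (m : ℕ) * (q ^ (m : ℕ)) ^ c by
      funext c; rw [Nat.mul_succ, pow_add, pow_mul, mul_comm],
    tsum_mul_left, tsum_geometric_of_norm_lt_one hqm, div_eq_mul_inv]

omit [NeZero N] in
/-- **The Lambert series as a divisor sum**: `T = ∑_{n ≥ 1} (∑_{d ∣ n} ψ(d) d) qⁿ`.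
[cite: DiamondShurman2005, Thm. 4.6.2] -/
theorem tsum_lambertTerm_eq {q : ℂ} (hq : ‖q‖ < 1) :
    ∑' m : ℕ, lambertTerm ψ q m =
      ∑' n : ℕ+, (∑ d ∈ (n : ℕ).divisors, ψ d * (d : ℂ)) * q ^ (n : ℕ) := by
  -- drop the `m = 0` term and pass to `ℕ+`
  rw [(summable_lambertTerm hq).tsum_eq_zero_add]
  have h0 : lambertTerm ψ q 0 = 0 := by simp [lambertTerm_def]
  rw [h0, zero_add, ← tsum_pnat_eq_tsum_succ (f := lambertTerm ψ q)]
  -- the double family `(c, m) ↦ ψ(m) m q^{cm}` and its swap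
  set W : ℕ → ℕ → ℂ := fun _ m ↦ ψ m with hW
  have hWb : ∀ c m, ‖W c m‖ ≤ 1 := fun _ m ↦ norm_dirichletCharacter_le_one m
  have hF : Summable fun p : ℕ+ × ℕ+ ↦ W p.1 p.2 * (p.2 : ℂ) ^ 1 * q ^ ((p.1 : ℕ) * (p.2 : ℕ)) :=
    summable_prod_weight_mul_pow' 1 W hq hWb
  have hF' : Summable fun p : ℕ+ × ℕ+ ↦ W p.2 p.1 * (p.1 : ℂ) ^ 1 * q ^ ((p.2 : ℕ) * (p.1 : ℕ)) :=
    (Equiv.prodComm ℕ+ ℕ+).summable_iff.mpr hF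
  -- `∑_m ψ(m) m q^m/(1−q^m) = ∑_m ∑_c ψ(m) m q^{cm}`
  have h1 : ∑' m : ℕ+, lambertTerm ψ q m =
      ∑' m : ℕ+, ∑' c : ℕ+, W c m * (m : ℂ) ^ 1 * q ^ ((c : ℕ) * (m : ℕ)) := by
    refine tsum_congr fun m ↦ ?_
    rw [lambertTerm_def, mul_div_assoc, pow_div_one_sub_eq_tsum hq m, ← tsum_mul_left, ← tsum_mul_left]
    refine tsum_congr fun c ↦ ?_
    simp only [hW, pow_one]
    ring
  have h2 : ∑' p : ℕ+ × ℕ+, W p.2 p.1 * (p.1 : ℂ) ^ 1 * q ^ ((p.2 : ℕ) * (p.1 : ℕ)) =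
      ∑' p : ℕ+ × ℕ+, W p.1 p.2 * (p.2 : ℂ) ^ 1 * q ^ ((p.1 : ℕ) * (p.2 : ℕ)) :=
    (Equiv.prodComm ℕ+ ℕ+).tsum_eq (fun p ↦ W p.1 p.2 * (p.2 : ℂ) ^ 1 * q ^ ((p.1 : ℕ) * (p.2 : ℕ)))
  rw [h1, ← hF'.tsum_prod, h2, tsum_prod_weight_mul_pow_eq 1 W hq hWb]
  refine tsum_congr fun n ↦ ?_
  congr 1
  rw [Nat.sum_divisorsAntidiagonal' (f := fun c m ↦ W c m * (m : ℂ) ^ 1)]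
  refine Finset.sum_congr rfl fun d _ ↦ ?_
  simp only [hW, pow_one]

/-! ### The identity `∑_j ψ(j) G_j = −2E₂^{𝟙,ψ}` -/

variable (ψ) in
/-- **`∑_{j mod N} ψ(j) G_j(τ) = −2 · E₂^{𝟙,ψ}(τ)`** for `ψ` primitive, even and non-trivial: the
weight-two Eisenstein series of `ψ` is `−½ ∑_b ψ(b) G_b`, `2πi·12·G_b = (log 𝒱_b)′`
(`SiegelUnitsProduct.logDeriv_siegelLevel`), i.e. `E₂^{𝟙,ψ}(z) dz` is `−(48πi)⁻¹ d log ∏_b 𝒱_b^{ψ(b)}`.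
Constant terms: `∑ψ(j)(N/2)B₂(j/N) = B_{2,ψ}/2 = −2a₀(E₂^{𝟙,ψ})`; higher terms: both progressions
give the Lambert series `∑ψ(m)mq^m/(1−q^m) = ∑σ₁^ψ(n)qⁿ`.
[cite: DiamondShurman2005, Thm. 4.6.2 and §4.8] [cite: KubertLang1981, Ch. 4 §1]
[cite: BillereyMenares2018, §1.3 (7.1.3)] -/
theorem sum_character_mul_siegelG (hψ : ψ.IsPrimitive) (hψ1 : ψ ≠ 1) (heven : ψ (-1) = 1)
    (τ : ℍ) : ∑ j : ZMod N, ψ j * siegelG N j.val τ = -2 * eisensteinE2Char ψ τ := by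
  have hq : ‖𝕢 1 (τ : ℂ)‖ < 1 := norm_qParam_lt_one' τ.2
  have hqe : 𝕢 1 (τ : ℂ) = cexp (2 * π * I * τ) := by simp [Periodic.qParam]
  have hsplit : ∑ j : ZMod N, ψ j * siegelG N j.val τ =
      ∑ j : ZMod N, ψ j * (siegelR N j.val / 12) -
      ∑ j : ZMod N, ψ j * ∑' n : ℕ, ((N * n + j.val : ℕ) : ℂ) * (𝕢 1 (τ : ℂ)) ^ (N * n + j.val) /
        (1 - (𝕢 1 (τ : ℂ)) ^ (N * n + j.val)) -
      ∑ j : ZMod N, ψ j * ∑' n : ℕ, ((N * n + (N - j.val) : ℕ) : ℂ) *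
        (𝕢 1 (τ : ℂ)) ^ (N * n + (N - j.val)) / (1 - (𝕢 1 (τ : ℂ)) ^ (N * n + (N - j.val))) := by
    simp only [siegelG_def, mul_sub, Finset.sum_sub_distrib]
  rw [hsplit, sum_character_mul_siegelR, sum_character_mul_tsum_prog hq,
    sum_character_mul_tsum_prog' hψ1 heven hq, tsum_lambertTerm_eq hq,
    eisensteinE2Char_apply ψ hψ hψ1 heven τ, eisensteinE2CharConst_mul_LFunction_two ψ hψ heven, hqe]
  ring

end Star

/-! ### Holomorphic logarithms of the units and their derivative -/

section Log

variable {N : ℕ} [NeZero N]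

/-- **A holomorphic logarithm of `𝒱_b` on `ℍ`** (`N ∤ b`): `ℍ` is simply connected and `𝒱_b` is
holomorphic and nowhere zero (tree `exists_continuous_cexp_eq`, `mdifferentiable_of_cexp_eq`).
[cite: KubertLang1981, Ch. 4 §1] -/
theorem exists_mdifferentiable_log_siegelLevel {b : ℤ} (hb : ¬ (N : ℤ) ∣ b) :
    ∃ L : ℍ → ℂ, MDiff L ∧ ∀ τ, cexp (L τ) = siegelLevel N b τ := by
  obtain ⟨L, hLc, hLe⟩ := exists_continuous_cexp_eq (continuous_siegelLevel hb)
    (fun τ ↦ siegelLevel_ne_zero N hb τ)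
  exact ⟨L, mdifferentiable_of_cexp_eq (mdifferentiable_siegelLevel hb) hLc hLe, hLe⟩

/-- Two continuous logarithms of `𝒱_b`-type functions differ by a constant: if `e^{L₁} = e^{L₂}` on
`ℍ` with `L₁, L₂` continuous then `L₁ − L₂` is constant (`ℍ` is connected). [folklore] -/
theorem exists_sub_eq_const_of_cexp_eq {L₁ L₂ : ℍ → ℂ} (h₁ : Continuous L₁) (h₂ : Continuous L₂)
    (he : ∀ τ, cexp (L₁ τ) = cexp (L₂ τ)) : ∃ c : ℂ, ∀ τ, L₁ τ = L₂ τ + c := by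
  refine ⟨L₁ UpperHalfPlane.I - L₂ UpperHalfPlane.I, fun τ ↦ ?_⟩
  have hE : (Set.univ : Set ℍ).EqOn L₁ (fun τ ↦ L₂ τ + (L₁ UpperHalfPlane.I - L₂ UpperHalfPlane.I)) :=
    eqOn_of_cexp_eq isPreconnected_univ h₁.continuousOn (h₂.add continuous_const).continuousOn
      (fun τ _ ↦ by rw [Complex.exp_add, ← he τ, show L₁ UpperHalfPlane.I - L₂ UpperHalfPlane.I =
        L₁ UpperHalfPlane.I + -L₂ UpperHalfPlane.I from sub_eq_add_neg _ _, Complex.exp_add,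
        he UpperHalfPlane.I, ← Complex.exp_add, add_neg_cancel, Complex.exp_zero, mul_one])
      (Set.mem_univ UpperHalfPlane.I) (by simp)
  exact hE (Set.mem_univ τ)

/-- **`(L_b ∘ ofComplex)′ = 2πi · 12 · G_b`** for a holomorphic logarithm `L_b` of `𝒱_b`, `0 < b < N`
(differentiate `e^{L_b} = 𝒱_b`: `L′ = logDeriv 𝒱_b`). [cite: DiamondShurman2005, §4.8] -/
theorem deriv_log_siegelLevel_nat {b : ℕ} (hb0 : 0 < b) (hbN : b < N) {L : ℍ → ℂ} (hL : MDiff L)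
    (hLe : ∀ τ, cexp (L τ) = siegelLevel N b τ) {x : ℂ} (hx : x ∈ ℍₒ) :
    deriv (L ∘ ofComplex) x = 2 * π * I * 12 * siegelG N b x := by
  have hLd : DifferentiableAt ℂ (L ∘ ofComplex) x :=
    ((UpperHalfPlane.mdifferentiable_iff.mp hL) x hx).differentiableAt
      (isOpen_upperHalfPlaneSet.mem_nhds hx)
  have hV : (fun y ↦ siegelLevel N b (ofComplex y)) = cexp ∘ (L ∘ ofComplex) :=
    funext fun y ↦ (hLe _).symm
  have h := logDeriv_siegelLevel hb0 hbN hx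
  rw [hV, logDeriv_comp (by fun_prop) hLd, Complex.logDeriv_exp] at h
  simpa using h

/-- **`(L_b ∘ ofComplex)′ = 2πi · 12 · G_{b mod N}`** for every `b ∈ ℤ` with `N ∤ b` and every
holomorphic logarithm `L_b` of `𝒱_b`. [cite: DiamondShurman2005, §4.8] -/
theorem deriv_log_siegelLevel {b : ℤ} (hb : ¬ (N : ℤ) ∣ b) {L : ℍ → ℂ} (hL : MDiff L)
    (hLe : ∀ τ, cexp (L τ) = siegelLevel N b τ) {x : ℂ} (hx : x ∈ ℍₒ) :
    deriv (L ∘ ofComplex) x = 2 * π * I * 12 * siegelG N (b % (N : ℤ)).toNat x := by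
  refine deriv_log_siegelLevel_nat (toNat_emod_pos hb) (toNat_emod_lt b) hL (fun τ ↦ ?_) hx
  rw [hLe, siegelLevel_eq_siegelLevel_toNat_emod]

end Log


end Literature.NumberTheory.ModularForms

end
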